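import Summits.QuantumFields.YangMills.Theorems.UnitScaleTiltProp7Crit93AtMemberTwoSlotT3
import Summits.QuantumFields.YangMills.Theorems.UnitScaleTiltProp7H128OfCrit127Family
import Summits.QuantumFields.YangMills.Theorems.UnitScaleTiltProp7ChartConjPInvT3
import Summits.QuantumFields.YangMills.Theorems.UnitScaleTiltProp7QkOntoOfRegPr
import Summits.QuantumFields.YangMills.Theorems.UnitScaleTiltProp7SolutionRealityRowSLift
import HarnessLib

/-!
# LIFT-THREAD 2, link D16 (★★OWNER RULING №30; namer ★w2-19200 g9 PEN ASSIGNMENT v1 17:22:48Z «★routeR-w1 g12: D20 → D16»; token convention (α)(β)(γ) of record 17:25:31Z; px12 g11 SED LIST v0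
# 2bd9ff01 §T2): **THE SED-TWIN OF ✓`Prop7HCrit93OfRow84Family.hCrit93_of_row84_at_record` WITH THE LIFT ANTECEDENT `Lift L i U₀ →` OF RECORD** — (α) the OPAQUE member-indexed predicate
# `Lift : ∀ L (i : Idx L), GaugeField … → Prop` as first explicit binder (instantiated only by the S-files, by the 6-line parallel-lift clause of SIGNATURE-0 S43ᴸT2 532e4a64); (β) inserted after
# the last regularity guard in every N06-descended row of the door — the class row `hPos₁`, the (R-W) row `hWR` and the (46)₀ row `h46₀` (`RegPr … (α L) U₀ → Lift L i U₀ →`; `hWR` ⟸ `hRC` ⟸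
# `norm_Hπ`, `h46₀` ⟸ `norm_Hπ` by ✓`h46_rows_of_norm115` under the uniform face), the cap-shaped letter rows `norm_G`∕`prop4`∕`norm_H₁` (`ρ ≤ α L → Lift L i U₀ →`), the two at-record rows
# `hZ84`∕`hchart` and the CONCLUSION at LIFT-THREAD 1's position (`CloseAvg … V U₀ → Lift L i U₀ → … ≤ α L →`; = px20 g8's D15∕D14 conclusions); the numeral-fed reality rows `h𝒢R`∕`hH₁R`∕`hHfR`
# stay antecedent-free (px12 §T1); (γ) namespace `…Prop7HCrit93OfRow84FamilyLift`, theorem name unchanged; the (R-A₁) step now reads routeR-w1 g12's D20 twin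
# ✓∕⧗`Prop7SolutionRealityRowSLift.hA₁R_of_letterReality Lift …` (imported).  Proof = v1's VERBATIM with `hLift` introduced after `hclose` and passed at the seven places where rows are read at
# the fibre point `U₀` (px12 g11 LOCATE «STRATUM (c) AND THE 13 N06 ROWS» d8153c1b: the intrinsic `R_S`-rows are inhabitable only on the lift locus, where the EX junction consumes them).
# CONDITIONAL door; nothing of the 13 rows, `hThm2S`, EX or the crux is proved; rung R3 (YM₃ on T³) — NOT d = 4, NOT infinite volume, NOT a mass gap, NOT Clay; the YM mass gap is NOT proved.
# Cell `ym3-torus`, twin-width seat `ym-routeR-w1` (gen 12); `--supports stmt-QuantumFields-19200 --as helper`, count-neutral.  Below, the v1 module docstring VERBATIM for provenance.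
#
# (v1) Route `UnitScaleTilt`, crux «MinimiserStabilityRegPr» (stmt-QuantumFields-19200, stub EX), route (α) — **«HCRIT93-FAMILY»: THE EX DISPLAY's ROW `hCrit93′` (print's (93): the chart ray of the Wilson
# action is critical along the Landau slice at the solution of (111)) AS A THEOREM, AT THE LETTERS OF RECORD, FROM THE TWO ROWS `hZ84` (lattice (84)) AND `hchart` ((47)∕(51) conjugacy) THAT
# ★px16's H128 door ✓`Prop7H128OfCrit127FamilyAtRecord` ALREADY READS (binder texts VERBATIM), THE CLASS ROW `hPos₁`, AND THE DISPLAY's LETTER ROWS** (EX namer ★w2-19200 g7 WORD (19)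
# 2026-08-29T01:27Z «px21 g4: HCRIT93-OF-ROW84 GO … it lands as an inhabitant now and as a descent in S18 next to px16's rows (same two rows feed both)»).

Cell `ym3-torus` (HUMAN RULING D-0037, YM ladder rung R3 — YM₃ on T³, NOT d = 4, NOT Clay; YM gap NOT proved), width seat `ym3-torus-px21` (gen 4).  THEOREMS ONLY (0 `def`, 0 `sorry`);
`--supports stmt-QuantumFields-19200 --as helper`, count-neutral; NOT a display change by itself; nothing of the stub ∕ crux ∕ gap claimed.

THE PRINT.  [Balaban1985Variational] p.291 (93) «⟨(δ∕δA′)𝔉(A′), δA′⟩ = 0 for δA′ in (83)» at the critical chart value; pp.293–294: (99)–(111) derive the fixed-point equation (111) from it;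
conversely (the direction used here) a solution of (111) makes (99) hold for every slice direction — (102)–(103) «⟨δA′, Δ₁H₁B⟩ = 0», (105) «⟨𝔓δA, J⟩ = ⟨δA, 𝔓*J⟩», (110) `G₁𝔓* = 𝔊` — and
(84) turns (99) into the vanishing of the ray derivative; [Balaban1985BackgroundPropagators] (3.127)–(3.128): `Δ₁ = Pᵀ(Δ^η + T_J)P` agrees with `Δ^η + T_J` on Landau pairs ((3.119)).

WHAT IS PROVED (ns `…Theorems.Prop7HCrit93OfRow84Family`): ★★★`hCrit93_of_row84_at_record` — conclusion = ✓p681225's `hCrit93` binder (:117–137; = S16ᴰ's `hCrit93` row up to the opaque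
`Wf`) VERBATIM; hypotheses = ✓p681225's binders VERBATIM (`Wf norm_G prop4 norm_H₁ h𝒢R hWR hH₁R hrα hr4 hr16 BH hBH0 h46₀ hHfR ef hef hWe hWε ε′ hq47 hR6 hrε2 Tcf hZ84 hchart`) minus
`Lift hSplit127 hΔxtr`, plus `ha` (S16ᴰ's `0 < a`), `hWQ`, `hPos₁` (S16ᴰ VERBATIM).  Member by member: ✓p680716's numerics∕reality block (T6's), the slice direction read back into the
(115)-space (`δ′ := ι⁻¹((ηi)⁻¹•δ)`: skew-Hermitian `δ` ↦ Hermitian `ιδ′`; `QTwS`∕Landau by linearity), ★px21 ✓`eventually_isHermitian_trace_zero_chart` (reality of the chart value near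
`t = 0`), then ★px21 ✓`Prop7Crit93AtMemberTwoSlot.deriv_chartRay_eq_zero_of_eq111_twoSlot_ev` at `TJ := TJSlotP` on `PosOnto … (DeltaOnePJ …) U₀` (`hPos₁` + ✓`surjective_Qk_of_regPr`).
HONEST SCOPE.  Composition by name; (84), the chart conjugacy, the class and the letter rows are HYPOTHESES with the suppliers of record; nothing of print is asserted; not a proof of the stub.

References: T. Bałaban, CMP **102** (1985) 277–309 [Balaban1985Variational] ((82)–(84) p.290, (87) p.291, (93) p.291, (99)–(105) p.293, (110)–(112) p.294, (47)–(51) pp.285–286, Prop. 6 p.295,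
(19)–(20) p.281); CMP **99** (1985) 389–434 [Balaban1985BackgroundPropagators] ((3.1) p.390, (3.6)–(3.7) p.391, (3.19) p.393, (3.119) p.419, (3.127)–(3.128) p.421).
-/

set_option autoImplicit false
noncomputable section
open scoped InnerProductSpace BigOperators Matrix.Norms.L2Operator Matrix Topology

namespace Summit.QuantumFields.YangMills.Theorems.Prop7HCrit93OfRow84FamilyLift

open NormedSpace
open Literature.Analysis.Calculus.ExpDifferential (ad gSer)
open Literature.MathematicalPhysics.QuantumFieldTheory.Balaban1983to89
open Literature.MathematicalPhysics.QuantumFieldTheory.Balaban1983to89.T3ContinuumYM3Torus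
open Literature.MathematicalPhysics.QuantumFieldTheory.Balaban1983to89.T3UnitLawDensityEML (ℰp)
open Literature.MathematicalPhysics.QuantumFieldTheory.Balaban1983to89.T3TiltDescent (descendTo)
open Literature.MathematicalPhysics.QuantumFieldTheory.Balaban1983to89.T3PrintedRegularMinimiser (RegPr)
open Literature.MathematicalPhysics.QuantumFieldTheory.Balaban1983to89.T3PrintedMinimiserExistence (regPr_mono)
open Literature.MathematicalPhysics.QuantumFieldTheory.Balaban1983to89.T3Thm1Carrier
open Literature.MathematicalPhysics.QuantumFieldTheory.Balaban1983to89.T3SectALandauChart (In19 emb15 CloseAvg eta)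
open B9SectCLatticeCarrier (Bond)
open B9Eq311L2Pairing (WL2)
open B11Eq115Space (NegSup NegSize Space115 JetSup)
open B11Eq111FrakG (nabla115)
open B11Eq98CurrentSlot (Jcur)
open B11Eq103H1Complex (BondL2K funEquiv)
open B11Eq90Transpose (pair27)
open B11Eq90V0primeCurrent (Tsh Ucur curL flat115)
open B9Eq3119DeltaPiCarrier (currentCLM)
open B9Eq39Adjoint (prodCfg)
open B9Eq31ActionZpow (actionZ)
open B11Prop3Model (Dfix)
open B13Contraction113 (QuadAnalytic)
open MatrixLog (mlog)
open Summit.QuantumFields.YangMills.Theorems.Prop7TPrint (expHermField)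
open Summit.QuantumFields.YangMills.Theorems.Prop7SPrint (IsLandauPrintS isLandauPrintS_iff_RS)
open Summit.QuantumFields.YangMills.Theorems.Prop7SectET3Transport (periodsT3 bgOfCfg bondEquiv)
open Summit.QuantumFields.YangMills.Theorems.Prop7SectET3HilbertLetters (W₂ frobEquiv toL2)
open Summit.QuantumFields.YangMills.Theorems.Prop7SectET3CurvedPropagators (Qk H1f frakGfR laplaceA PosOnto)
open Summit.QuantumFields.YangMills.Theorems.Prop7SectET3WilsonHessian (DeltaEtaSlot)
open Summit.QuantumFields.YangMills.Theorems.Prop7SectET3DeltaOnePInv (TJSlotP DeltaOnePJ)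
open Summit.QuantumFields.YangMills.Theorems.Prop7SectET3DeltaPiPInv (H46P)
open Summit.QuantumFields.YangMills.Theorems.Prop7SymAvgTwSym (QTwS CmapTwS)
open Summit.QuantumFields.YangMills.Theorems.Prop7Bound20SymLog (bound20_symLog_of_closeAvg)
open Summit.QuantumFields.YangMills.Theorems.Prop7StubEXOfChartPiecesTwSR (bsym_isHermitian_trace_zero)
open Summit.QuantumFields.YangMills.Theorems.Prop7SolutionRealityRowSLift (hA₁R_of_letterReality)
open Summit.QuantumFields.YangMills.Theorems.Prop7StubEXOfChartPiecesTwL (windows_of_admissible three_le_memberL)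
open Summit.QuantumFields.YangMills.Theorems.Prop7StubEXOfChartPiecesTwS (windows_of_W)
open Summit.QuantumFields.YangMills.Theorems.Prop7ChartDatumSplit (norm_jetRead_le)
open Summit.QuantumFields.YangMills.Theorems.Prop7ChartConjPInv (eventually_isHermitian_trace_zero_chart)
open Summit.QuantumFields.YangMills.Theorems.Prop7QkOntoOfRegPr (surjective_Qk_of_regPr)
open Summit.QuantumFields.YangMills.Theorems.Prop7Crit93AtMemberTwoSlot (deriv_chartRay_eq_zero_of_eq111_twoSlot_ev)

set_option maxHeartbeats 400000 in -- HEARTBEAT BUDGET rule (cell README): T6-size member numerics + reader rewrites under a ~50-binder context; line-neutral, decl-local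
/-- ★★★ **LIFT-THREAD 2, D16: THE DISPLAY's ROW `hCrit93′` AT THE LETTERS OF RECORD, FROM `hZ84` + `hchart` + `hPos₁` + THE LETTER ROWS, UNDER THE LIFT ANTECEDENT OF RECORD** (`Lift L i U₀ →` on `hPos₁ norm_G prop4 norm_H₁ hWR h46₀ hZ84 hchart` and on the conclusion; v1 = ✓`Prop7HCrit93OfRow84Family.hCrit93_of_row84_at_record`, text otherwise VERBATIM) (print's (93) ⟸ (111) + (84), two slots): for every member, every
`U₀ ∈ 𝔅_k(V)` printed-regular of radius `L³·3L·ε₁ ≤ α`, every solution `A₁` of (111) in the `r`-ball and every skew-Hermitian traceless slice direction `δ` (`QTwS U₀ δ = 0`, Landau), the chart ray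
`t ↦ 𝒜(exp((−i)•χ(κ_f•ι(A₁ + H₁B̃) + tδ))·U₀)` has derivative `0` at `t = 0`.  Hypotheses = ✓`Prop7H128OfCrit127FamilyAtRecord.h128Lift_of_crit93_split127_at_record`'s binders VERBATIM (minus `Lift hSplit127
hΔxtr hCrit93`) + `ha hWQ hPos₁` (S16ᴰ VERBATIM); conclusion = its `hCrit93` binder VERBATIM.
[cite: Balaban1985Variational, (93) p.291, (84) p.290, (87) p.291, (99)-(105) p.293, (110)-(112) p.294, (47)-(51) pp.285-286, Prop. 6 p.295, (19)-(20) p.281; Balaban1985BackgroundPropagators, (3.1) p.390, (3.6)-(3.7) p.391, (3.19) p.393, (3.119) p.419, (3.127)-(3.128) p.421] -/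
theorem hCrit93_of_row84_at_record
    [hFL : ∀ F : T3Family, Fact (0 < (F.L : ℝ))] [hFη : ∀ (F : T3Family) (k : ℕ), Fact (0 < ((F.L : ℝ)⁻¹) ^ k)]
    -- (LIFT-THREAD 2) the OPAQUE member-indexed lift predicate of record (the S-files instantiate it by the 6-line clause of SIGNATURE-0 S43ᴸT2 532e4a64)
    (Lift : ∀ (L : ℕ) (i : Idx L), GaugeField (i.1.1.P i.1.2.2) 0 (Matrix.specialUnitaryGroup (Fin 2) ℂ) → Prop)
    (B₀ C₄ a₃ α r : ℕ → ℝ) (hB₀ : ∀ L, 1 < L → 0 < B₀ L) (hC₄ : ∀ L, 1 < L → 0 < C₄ L)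
    (hα : ∀ L, 1 < L → 0 < α L)
    (c₀ cB : ℕ → ℝ) [hc₀ : ∀ L : ℕ, Fact (0 < c₀ L)] [hcB : ∀ L : ℕ, Fact (0 < cB L)]
    (a : ∀ L : ℕ, Idx L → ℝ) (ha : ∀ (L : ℕ) (i : Idx L), 0 < a L i)
    -- the (3.19) window («Q′ onto», ✓`surjective_Qk_of_regPr`) and the CLASS ROW `hPos₁` at the letter slot `Δ₁ᴾ` (S16ᴰ VERBATIM) — together `PosOnto … (DeltaOnePJ …) U₀`
    (hWQ : ∀ L : ℕ, 1 < L → 13 * 10 ^ 14 * (L : ℝ) ^ 3 * α L ≤ 1)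
    (hPos₁ : ∀ (L : ℕ), 1 < L → ∀ (i : Idx L) (U₀ : GaugeField (i.1.1.P i.1.2.2) 0 (Matrix.specialUnitaryGroup (Fin 2) ℂ)), RegPr i.1.1 i.1.2.1 i.1.2.2 (α L) U₀ → Lift L i U₀ →
      ∀ x : BondL2K ℂ 3 (periodsT3 i.1.1 i.1.2.2) (c₀ L) W₂, x ≠ 0 →
        0 < RCLike.re ⟪x, laplaceA i.1.1 i.1.2.1 i.1.2.2 i.2.2.le (c₀ L) (cB L) (a L i) (DeltaOnePJ i.1.1 i.1.2.1 i.1.2.2 i.2.2.le (c₀ L) (cB L) (a L i)) U₀ x⟫_ℂ)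
    (Wf : ∀ (L : ℕ) (i : Idx L) (U₀ : GaugeField (i.1.1.P i.1.2.2) 0 (Matrix.specialUnitaryGroup (Fin 2) ℂ)),
      Space115 (i.1.1.L : ℝ) (((i.1.1.L : ℝ)⁻¹) ^ (i.1.2.2 - i.1.2.1)) (fun _ : Bond 3 (periodsT3 i.1.1 i.1.2.2) => i.1.2.2 - i.1.2.1)
          (fun _ : Bond 3 (periodsT3 i.1.1 i.1.2.2) × Fin 3 => i.1.2.2 - i.1.2.1) (nabla115 (((i.1.1.L : ℝ)⁻¹) ^ (i.1.2.2 - i.1.2.1)) (bgOfCfg i.1.1 i.1.2.2 U₀)) →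
        NegSize (i.1.1.L : ℝ) (((i.1.1.L : ℝ)⁻¹) ^ (i.1.2.2 - i.1.2.1)) (fun _ : Bond 3 (periodsT3 i.1.1 i.1.2.2) => i.1.2.2 - i.1.2.1) 3 (Matrix (Fin 2) (Fin 2) ℂ))
    -- their displayed bounds and reality rows (the knit's rows verbatim)
    (norm_G : ∀ (L : ℕ), 1 < L → ∀ (i : Idx L) (ρ : ℝ) (U₀ : GaugeField (i.1.1.P i.1.2.2) 0 (Matrix.specialUnitaryGroup (Fin 2) ℂ)),
      RegPr i.1.1 i.1.2.1 i.1.2.2 ρ U₀ → ρ ≤ α L → Lift L i U₀ → ∀ f, ‖frakGfR i.1.1 i.1.2.1 i.1.2.2 i.2.2.le (c₀ L) (cB L) (a L i) (DeltaOnePJ i.1.1 i.1.2.1 i.1.2.2 i.2.2.le (c₀ L) (cB L) (a L i)) U₀ f‖ ≤ B₀ L * ‖f‖)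
    (prop4 : ∀ (L : ℕ), 1 < L → ∀ (i : Idx L) (ρ : ℝ) (U₀ : GaugeField (i.1.1.P i.1.2.2) 0 (Matrix.specialUnitaryGroup (Fin 2) ℂ)),
      RegPr i.1.1 i.1.2.1 i.1.2.2 ρ U₀ → ρ ≤ α L → Lift L i U₀ → QuadAnalytic (Wf L i U₀) (C₄ L) (a₃ L))
    (norm_H₁ : ∀ (L : ℕ), 1 < L → ∀ (i : Idx L) (ρ : ℝ) (U₀ : GaugeField (i.1.1.P i.1.2.2) 0 (Matrix.specialUnitaryGroup (Fin 2) ℂ)),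
      RegPr i.1.1 i.1.2.1 i.1.2.2 ρ U₀ → ρ ≤ α L → Lift L i U₀ → ∀ b, ‖H1f i.1.1 i.1.2.1 i.1.2.2 i.2.2.le (c₀ L) (cB L) (a L i) (DeltaOnePJ i.1.1 i.1.2.1 i.1.2.2 i.2.2.le (c₀ L) (cB L) (a L i)) U₀ b‖ ≤ B₀ L * ‖b‖)
    (h𝒢R : ∀ (L : ℕ), 1 < L → ∀ (i : Idx L) (U₀ : GaugeField (i.1.1.P i.1.2.2) 0 (Matrix.specialUnitaryGroup (Fin 2) ℂ)), RegPr i.1.1 i.1.2.1 i.1.2.2 (α L) U₀ →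
      ∀ f : NegSize (i.1.1.L : ℝ) (((i.1.1.L : ℝ)⁻¹) ^ (i.1.2.2 - i.1.2.1)) (fun _ : Bond 3 (periodsT3 i.1.1 i.1.2.2) => i.1.2.2 - i.1.2.1) 3 (Matrix (Fin 2) (Fin 2) ℂ),
        (∀ b, (NegSup.equiv _ _ f b).IsHermitian ∧ (NegSup.equiv _ _ f b).trace = 0) →
        ∀ b, (JetSup.equiv _ _ _ (frakGfR i.1.1 i.1.2.1 i.1.2.2 i.2.2.le (c₀ L) (cB L) (a L i) (DeltaOnePJ i.1.1 i.1.2.1 i.1.2.2 i.2.2.le (c₀ L) (cB L) (a L i)) U₀ f) b).IsHermitian ∧ (JetSup.equiv _ _ _ (frakGfR i.1.1 i.1.2.1 i.1.2.2 i.2.2.le (c₀ L) (cB L) (a L i) (DeltaOnePJ i.1.1 i.1.2.1 i.1.2.2 i.2.2.le (c₀ L) (cB L) (a L i)) U₀ f) b).trace = 0)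
    (hWR : ∀ (L : ℕ), 1 < L → ∀ (i : Idx L) (U₀ : GaugeField (i.1.1.P i.1.2.2) 0 (Matrix.specialUnitaryGroup (Fin 2) ℂ)), RegPr i.1.1 i.1.2.1 i.1.2.2 (α L) U₀ → Lift L i U₀ →
      ∀ A : Space115 (i.1.1.L : ℝ) (((i.1.1.L : ℝ)⁻¹) ^ (i.1.2.2 - i.1.2.1)) (fun _ : Bond 3 (periodsT3 i.1.1 i.1.2.2) => i.1.2.2 - i.1.2.1)
          (fun _ : Bond 3 (periodsT3 i.1.1 i.1.2.2) × Fin 3 => i.1.2.2 - i.1.2.1) (nabla115 (((i.1.1.L : ℝ)⁻¹) ^ (i.1.2.2 - i.1.2.1)) (bgOfCfg i.1.1 i.1.2.2 U₀)),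
        ‖A‖ < a₃ L → (∀ b, (JetSup.equiv _ _ _ A b).IsHermitian ∧ (JetSup.equiv _ _ _ A b).trace = 0) →
        ∀ b, (NegSup.equiv _ _ (Wf L i U₀ A) b).IsHermitian ∧ (NegSup.equiv _ _ (Wf L i U₀ A) b).trace = 0)
    (hH₁R : ∀ (L : ℕ), 1 < L → ∀ (i : Idx L) (U₀ : GaugeField (i.1.1.P i.1.2.2) 0 (Matrix.specialUnitaryGroup (Fin 2) ℂ)), RegPr i.1.1 i.1.2.1 i.1.2.2 (α L) U₀ →
      ∀ B : PBond (i.1.1.P i.1.2.1) 0 → Matrix (Fin 2) (Fin 2) ℂ, (∀ c, (B c).IsHermitian ∧ (B c).trace = 0) →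
        ∀ b' : PBond (i.1.1.P i.1.2.2) 0, (JetSup.equiv _ _ _ (H1f i.1.1 i.1.2.1 i.1.2.2 i.2.2.le (c₀ L) (cB L) (a L i) (DeltaOnePJ i.1.1 i.1.2.1 i.1.2.2 i.2.2.le (c₀ L) (cB L) (a L i)) U₀ B) (bondEquiv i.1.1 i.1.2.2 b')).IsHermitian ∧
          (JetSup.equiv _ _ _ (H1f i.1.1 i.1.2.1 i.1.2.2 i.2.2.le (c₀ L) (cB L) (a L i) (DeltaOnePJ i.1.1 i.1.2.1 i.1.2.2 i.2.2.le (c₀ L) (cB L) (a L i)) U₀ B) (bondEquiv i.1.1 i.1.2.2 b')).trace = 0)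
    -- the Prop. 6 windows, the (46) letter `Hf` with its bound∕reality rows, (WF), the chart windows, the half-ball window `hrε2` (T6 VERBATIM)
    (hrα : ∀ L : ℕ, 1 < L → 2 * B₀ L * α L ≤ r L) (hr4 : ∀ L : ℕ, 1 < L → 4 * r L ≤ a₃ L) (hr16 : ∀ L : ℕ, 1 < L → 16 * B₀ L * C₄ L * r L ≤ 1)
    (BH : ℕ → ℝ) (hBH0 : ∀ L : ℕ, 1 < L → 0 ≤ BH L)
    (h46₀ : ∀ (L : ℕ), 1 < L → ∀ (i : Idx L) (U₀ : GaugeField (i.1.1.P i.1.2.2) 0 (Matrix.specialUnitaryGroup (Fin 2) ℂ)), RegPr i.1.1 i.1.2.1 i.1.2.2 (α L) U₀ → Lift L i U₀ →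
      ∀ Y, ‖H46P i.1.1 i.1.2.1 i.1.2.2 i.2.2.le (c₀ L) (cB L) (a L i) U₀ Y‖ ≤ BH L * eta i.1.1 i.1.2.1 i.1.2.2 * ‖Y‖)
    (hHfR : ∀ (L : ℕ), 1 < L → ∀ (i : Idx L) (U₀ : GaugeField (i.1.1.P i.1.2.2) 0 (Matrix.specialUnitaryGroup (Fin 2) ℂ)), RegPr i.1.1 i.1.2.1 i.1.2.2 (α L) U₀ →
      ∀ Y, (∀ c, star (Y c) = -Y c ∧ (Y c).trace = 0) → ∀ b', star (H46P i.1.1 i.1.2.1 i.1.2.2 i.2.2.le (c₀ L) (cB L) (a L i) U₀ Y b') = -H46P i.1.1 i.1.2.1 i.1.2.2 i.2.2.le (c₀ L) (cB L) (a L i) U₀ Y b' ∧ (H46P i.1.1 i.1.2.1 i.1.2.2 i.2.2.le (c₀ L) (cB L) (a L i) U₀ Y b').trace = 0)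
    (ef : ℕ → ℝ) (hef : ∀ L, 1 < L → 0 < ef L)
    (hWe : ∀ L : ℕ, 1 < L → 10 ^ 9 * (L : ℝ) ^ 2 * ef L ≤ 1) (hWε : ∀ L : ℕ, 1 < L → 10 ^ 12 * (L : ℝ) ^ 3 * α L ≤ 1)
    (ε' : ℕ → ℝ) (hq47 : ∀ L : ℕ, 1 < L → 9 * (40 * (2 * (3 * (2 * ef L + 2700 * (L : ℝ) * α L))) / ef L ^ 2) * BH L * ε' L < 1)
    (hR6 : ∀ L : ℕ, 1 < L → 6 * ε' L ≤ ef L)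
    (hrε2 : ∀ L : ℕ, 1 < L → 2 * (r L + 2 * B₀ L * α L) ≤ ε' L)
    -- the (115)-LEVEL CHART LETTER `Tcf` (OPAQUE, like `Wf`; ★px21 ✓`Prop7ChartConjPInv` names `T47 H̃ᴾ C̃ εC`)
    (Tcf : ∀ (L : ℕ) (i : Idx L) (U₀ : GaugeField (i.1.1.P i.1.2.2) 0 (Matrix.specialUnitaryGroup (Fin 2) ℂ)),
      Space115 (i.1.1.L : ℝ) (((i.1.1.L : ℝ)⁻¹) ^ (i.1.2.2 - i.1.2.1)) (fun _ : Bond 3 (periodsT3 i.1.1 i.1.2.2) => i.1.2.2 - i.1.2.1)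
          (fun _ : Bond 3 (periodsT3 i.1.1 i.1.2.2) × Fin 3 => i.1.2.2 - i.1.2.1) (nabla115 (((i.1.1.L : ℝ)⁻¹) ^ (i.1.2.2 - i.1.2.1)) (bgOfCfg i.1.1 i.1.2.2 U₀)) →
        Space115 (i.1.1.L : ℝ) (((i.1.1.L : ℝ)⁻¹) ^ (i.1.2.2 - i.1.2.1)) (fun _ : Bond 3 (periodsT3 i.1.1 i.1.2.2) => i.1.2.2 - i.1.2.1)
          (fun _ : Bond 3 (periodsT3 i.1.1 i.1.2.2) × Fin 3 => i.1.2.2 - i.1.2.1) (nabla115 (((i.1.1.L : ℝ)⁻¹) ^ (i.1.2.2 - i.1.2.1)) (bgOfCfg i.1.1 i.1.2.2 U₀)))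
    -- ROW `hZ84` — lit (84): `HasDerivAt` of `actionZ` along `Tcf(A′ + tδ′)`, derivative `⟨δ′,J⟩ + ⟨δ′,Δ̂ₓA′⟩ + ⟨δ′,Ŵ(A′)⟩`, `A′ = A₁ + H₁B̃`, `Δ̂ₓ = currentCLM … ((DeltaEtaSlot i.1.1 i.1.2.1 i.1.2.2 (c₀ L) + TJSlotP i.1.1 i.1.2.1 i.1.2.2 i.2.2.le (c₀ L) (cB L) (a L i)) U₀)`, ∀ Hermitian-traceless `ιδ′ ∈ ker QTwS`; DISPLAYED
    (hZ84 : ∀ (L : ℕ), 1 < L → ∀ (i : Idx L) (ε₁ : ℝ) (V : GaugeField (i.1.1.P i.1.2.1) 0 (Matrix.specialUnitaryGroup (Fin 2) ℂ))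
      (U₀ : GaugeField (i.1.1.P i.1.2.2) 0 (Matrix.specialUnitaryGroup (Fin 2) ℂ)), 0 < ε₁ → PlaqSmall ε₁ V →
      RegPr i.1.1 i.1.2.1 i.1.2.2 ((L : ℝ) ^ 3 * (3 * (L : ℝ)) * ε₁) U₀ → CloseAvg i.1.1 i.1.2.1 i.1.2.2 i.2.2.le ((L : ℝ) ^ 3 * ε₁) V U₀ → Lift L i U₀ → (L : ℝ) ^ 3 * (3 * (L : ℝ)) * ε₁ ≤ α L →
      ∀ A₁ : Space115 (i.1.1.L : ℝ) (((i.1.1.L : ℝ)⁻¹) ^ (i.1.2.2 - i.1.2.1)) (fun _ : Bond 3 (periodsT3 i.1.1 i.1.2.2) => i.1.2.2 - i.1.2.1)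
          (fun _ : Bond 3 (periodsT3 i.1.1 i.1.2.2) × Fin 3 => i.1.2.2 - i.1.2.1) (nabla115 (((i.1.1.L : ℝ)⁻¹) ^ (i.1.2.2 - i.1.2.1)) (bgOfCfg i.1.1 i.1.2.2 U₀)),
        ‖A₁‖ < r L →
        A₁ + frakGfR i.1.1 i.1.2.1 i.1.2.2 i.2.2.le (c₀ L) (cB L) (a L i) (DeltaOnePJ i.1.1 i.1.2.1 i.1.2.2 i.2.2.le (c₀ L) (cB L) (a L i)) U₀ (Jcur (bgOfCfg i.1.1 i.1.2.2 U₀)) + frakGfR i.1.1 i.1.2.1 i.1.2.2 i.2.2.le (c₀ L) (cB L) (a L i) (DeltaOnePJ i.1.1 i.1.2.1 i.1.2.2 i.2.2.le (c₀ L) (cB L) (a L i)) U₀ (Wf L i U₀ (A₁ + H1f i.1.1 i.1.2.1 i.1.2.2 i.2.2.le (c₀ L) (cB L) (a L i) (DeltaOnePJ i.1.1 i.1.2.1 i.1.2.2 i.2.2.le (c₀ L) (cB L) (a L i)) U₀ (fun c : PBond (i.1.1.P i.1.2.1) 0 =>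
          (-Complex.I) • mlog (((V c : Matrix.specialUnitaryGroup (Fin 2) ℂ) : Matrix (Fin 2) (Fin 2) ℂ)
            * star ((descendTo i.1.1 ℰp i.1.2.1 i.1.2.2 i.2.2.le U₀ c : Matrix.specialUnitaryGroup (Fin 2) ℂ) : Matrix (Fin 2) (Fin 2) ℂ))))) = 0 →
        ∀ δ' : Space115 (i.1.1.L : ℝ) (((i.1.1.L : ℝ)⁻¹) ^ (i.1.2.2 - i.1.2.1)) (fun _ : Bond 3 (periodsT3 i.1.1 i.1.2.2) => i.1.2.2 - i.1.2.1)
          (fun _ : Bond 3 (periodsT3 i.1.1 i.1.2.2) × Fin 3 => i.1.2.2 - i.1.2.1) (nabla115 (((i.1.1.L : ℝ)⁻¹) ^ (i.1.2.2 - i.1.2.1)) (bgOfCfg i.1.1 i.1.2.2 U₀)),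
          (∀ b' : PBond (i.1.1.P i.1.2.2) 0, star (JetSup.equiv _ _ _ δ' (bondEquiv i.1.1 i.1.2.2 b')) = JetSup.equiv _ _ _ δ' (bondEquiv i.1.1 i.1.2.2 b')) →
          (∀ b' : PBond (i.1.1.P i.1.2.2) 0, Matrix.trace (JetSup.equiv _ _ _ δ' (bondEquiv i.1.1 i.1.2.2 b')) = 0) →
          QTwS i.1.1 i.1.2.1 i.1.2.2 i.2.2.le U₀ (fun b' : PBond (i.1.1.P i.1.2.2) 0 => JetSup.equiv _ _ _ δ' (bondEquiv i.1.1 i.1.2.2 b')) = 0 →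
          HasDerivAt (fun t : ℝ => actionZ Tsh (((i.1.1.L : ℝ)⁻¹) ^ (i.1.2.2 - i.1.2.1)) 3
            ((LinearMap.toContinuousLinearMap (Matrix.traceLinearMap (Fin 2) ℂ ℂ) : Matrix (Fin 2) (Fin 2) ℂ →L[ℂ] ℂ) : Matrix (Fin 2) (Fin 2) ℂ →ₗ[ℂ] ℂ)
            (prodCfg (Ucur (bgOfCfg i.1.1 i.1.2.2 U₀)) (((i.1.1.L : ℝ)⁻¹) ^ (i.1.2.2 - i.1.2.1)) (curL (flat115 (Tcf L i U₀ ((A₁ + H1f i.1.1 i.1.2.1 i.1.2.2 i.2.2.le (c₀ L) (cB L) (a L i) (DeltaOnePJ i.1.1 i.1.2.1 i.1.2.2 i.2.2.le (c₀ L) (cB L) (a L i)) U₀ (fun c : PBond (i.1.1.P i.1.2.1) 0 =>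
          (-Complex.I) • mlog (((V c : Matrix.specialUnitaryGroup (Fin 2) ℂ) : Matrix (Fin 2) (Fin 2) ℂ)
            * star ((descendTo i.1.1 ℰp i.1.2.1 i.1.2.2 i.2.2.le U₀ c : Matrix.specialUnitaryGroup (Fin 2) ℂ) : Matrix (Fin 2) (Fin 2) ℂ)))) + (t : ℂ) • δ'))))))
          (pair27 (LinearMap.toContinuousLinearMap (Matrix.traceLinearMap (Fin 2) ℂ ℂ)) (Jcur (bgOfCfg i.1.1 i.1.2.2 U₀) : NegSize (i.1.1.L : ℝ) (((i.1.1.L : ℝ)⁻¹) ^ (i.1.2.2 - i.1.2.1)) (fun _ : Bond 3 (periodsT3 i.1.1 i.1.2.2) => i.1.2.2 - i.1.2.1) 3 (Matrix (Fin 2) (Fin 2) ℂ)) (flat115 δ')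
            + pair27 (LinearMap.toContinuousLinearMap (Matrix.traceLinearMap (Fin 2) ℂ ℂ))
                (currentCLM frobEquiv (fun _ : Bond 3 (periodsT3 i.1.1 i.1.2.2) × Fin 3 => i.1.2.2 - i.1.2.1) (nabla115 (((i.1.1.L : ℝ)⁻¹) ^ (i.1.2.2 - i.1.2.1)) (bgOfCfg i.1.1 i.1.2.2 U₀)) ((DeltaEtaSlot i.1.1 i.1.2.1 i.1.2.2 (c₀ L) + TJSlotP i.1.1 i.1.2.1 i.1.2.2 i.2.2.le (c₀ L) (cB L) (a L i)) U₀) (A₁ + H1f i.1.1 i.1.2.1 i.1.2.2 i.2.2.le (c₀ L) (cB L) (a L i) (DeltaOnePJ i.1.1 i.1.2.1 i.1.2.2 i.2.2.le (c₀ L) (cB L) (a L i)) U₀ (fun c : PBond (i.1.1.P i.1.2.1) 0 =>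
          (-Complex.I) • mlog (((V c : Matrix.specialUnitaryGroup (Fin 2) ℂ) : Matrix (Fin 2) (Fin 2) ℂ)
            * star ((descendTo i.1.1 ℰp i.1.2.1 i.1.2.2 i.2.2.le U₀ c : Matrix.specialUnitaryGroup (Fin 2) ℂ) : Matrix (Fin 2) (Fin 2) ℂ)))))
                (flat115 δ')
            + pair27 (LinearMap.toContinuousLinearMap (Matrix.traceLinearMap (Fin 2) ℂ ℂ)) (Wf L i U₀ (A₁ + H1f i.1.1 i.1.2.1 i.1.2.2 i.2.2.le (c₀ L) (cB L) (a L i) (DeltaOnePJ i.1.1 i.1.2.1 i.1.2.2 i.2.2.le (c₀ L) (cB L) (a L i)) U₀ (fun c : PBond (i.1.1.P i.1.2.1) 0 =>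
          (-Complex.I) • mlog (((V c : Matrix.specialUnitaryGroup (Fin 2) ℂ) : Matrix (Fin 2) (Fin 2) ℂ)
            * star ((descendTo i.1.1 ℰp i.1.2.1 i.1.2.2 i.2.2.le U₀ c : Matrix.specialUnitaryGroup (Fin 2) ℂ) : Matrix (Fin 2) (Fin 2) ℂ))))) (flat115 δ')) 0)
    -- ROW `hchart` — (47)∕(51) conjugacy near `t = 0`: `κ_f • ι(Tcf(A′ + tδ′)) = χ(κ_f • ιA′ + t•κ_f•ιδ′)`, `χ(Y) = Y − Hf·Dfix(CmapTwS U₀) Hf C₂ˢ Y` (★px21 ✓`Prop7ChartConjPInv`); DISPLAYED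
    (hchart : ∀ (L : ℕ), 1 < L → ∀ (i : Idx L) (ε₁ : ℝ) (V : GaugeField (i.1.1.P i.1.2.1) 0 (Matrix.specialUnitaryGroup (Fin 2) ℂ))
      (U₀ : GaugeField (i.1.1.P i.1.2.2) 0 (Matrix.specialUnitaryGroup (Fin 2) ℂ)), 0 < ε₁ → PlaqSmall ε₁ V →
      RegPr i.1.1 i.1.2.1 i.1.2.2 ((L : ℝ) ^ 3 * (3 * (L : ℝ)) * ε₁) U₀ → CloseAvg i.1.1 i.1.2.1 i.1.2.2 i.2.2.le ((L : ℝ) ^ 3 * ε₁) V U₀ → Lift L i U₀ → (L : ℝ) ^ 3 * (3 * (L : ℝ)) * ε₁ ≤ α L →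
      ∀ A₁ : Space115 (i.1.1.L : ℝ) (((i.1.1.L : ℝ)⁻¹) ^ (i.1.2.2 - i.1.2.1)) (fun _ : Bond 3 (periodsT3 i.1.1 i.1.2.2) => i.1.2.2 - i.1.2.1)
          (fun _ : Bond 3 (periodsT3 i.1.1 i.1.2.2) × Fin 3 => i.1.2.2 - i.1.2.1) (nabla115 (((i.1.1.L : ℝ)⁻¹) ^ (i.1.2.2 - i.1.2.1)) (bgOfCfg i.1.1 i.1.2.2 U₀)),
        ‖A₁‖ < r L →
        A₁ + frakGfR i.1.1 i.1.2.1 i.1.2.2 i.2.2.le (c₀ L) (cB L) (a L i) (DeltaOnePJ i.1.1 i.1.2.1 i.1.2.2 i.2.2.le (c₀ L) (cB L) (a L i)) U₀ (Jcur (bgOfCfg i.1.1 i.1.2.2 U₀)) + frakGfR i.1.1 i.1.2.1 i.1.2.2 i.2.2.le (c₀ L) (cB L) (a L i) (DeltaOnePJ i.1.1 i.1.2.1 i.1.2.2 i.2.2.le (c₀ L) (cB L) (a L i)) U₀ (Wf L i U₀ (A₁ + H1f i.1.1 i.1.2.1 i.1.2.2 i.2.2.le (c₀ L) (cB L) (a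 L i) (DeltaOnePJ i.1.1 i.1.2.1 i.1.2.2 i.2.2.le (c₀ L) (cB L) (a L i)) U₀ (fun c : PBond (i.1.1.P i.1.2.1) 0 =>
          (-Complex.I) • mlog (((V c : Matrix.specialUnitaryGroup (Fin 2) ℂ) : Matrix (Fin 2) (Fin 2) ℂ)
            * star ((descendTo i.1.1 ℰp i.1.2.1 i.1.2.2 i.2.2.le U₀ c : Matrix.specialUnitaryGroup (Fin 2) ℂ) : Matrix (Fin 2) (Fin 2) ℂ))))) = 0 →
        ∀ δ' : Space115 (i.1.1.L : ℝ) (((i.1.1.L : ℝ)⁻¹) ^ (i.1.2.2 - i.1.2.1)) (fun _ : Bond 3 (periodsT3 i.1.1 i.1.2.2) => i.1.2.2 - i.1.2.1)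
          (fun _ : Bond 3 (periodsT3 i.1.1 i.1.2.2) × Fin 3 => i.1.2.2 - i.1.2.1) (nabla115 (((i.1.1.L : ℝ)⁻¹) ^ (i.1.2.2 - i.1.2.1)) (bgOfCfg i.1.1 i.1.2.2 U₀)),
          (∀ b' : PBond (i.1.1.P i.1.2.2) 0, star (JetSup.equiv _ _ _ δ' (bondEquiv i.1.1 i.1.2.2 b')) = JetSup.equiv _ _ _ δ' (bondEquiv i.1.1 i.1.2.2 b')) →
          (∀ b' : PBond (i.1.1.P i.1.2.2) 0, Matrix.trace (JetSup.equiv _ _ _ δ' (bondEquiv i.1.1 i.1.2.2 b')) = 0) →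
          QTwS i.1.1 i.1.2.1 i.1.2.2 i.2.2.le U₀ (fun b' : PBond (i.1.1.P i.1.2.2) 0 => JetSup.equiv _ _ _ δ' (bondEquiv i.1.1 i.1.2.2 b')) = 0 →
          ∀ᶠ t : ℝ in nhds 0,
            (((eta i.1.1 i.1.2.1 i.1.2.2 : ℝ) : ℂ) * Complex.I) • (fun b' : PBond (i.1.1.P i.1.2.2) 0 => JetSup.equiv _ _ _ (Tcf L i U₀ ((A₁ + H1f i.1.1 i.1.2.1 i.1.2.2 i.2.2.le (c₀ L) (cB L) (a L i) (DeltaOnePJ i.1.1 i.1.2.1 i.1.2.2 i.2.2.le (c₀ L) (cB L) (a L i)) U₀ (fun c : PBond (i.1.1.P i.1.2.1) 0 =>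
          (-Complex.I) • mlog (((V c : Matrix.specialUnitaryGroup (Fin 2) ℂ) : Matrix (Fin 2) (Fin 2) ℂ)
            * star ((descendTo i.1.1 ℰp i.1.2.1 i.1.2.2 i.2.2.le U₀ c : Matrix.specialUnitaryGroup (Fin 2) ℂ) : Matrix (Fin 2) (Fin 2) ℂ)))) + (t : ℂ) • δ')) (bondEquiv i.1.1 i.1.2.2 b'))
              = (((((eta i.1.1 i.1.2.1 i.1.2.2 : ℝ) : ℂ) * Complex.I) • ((fun b : PBond (i.1.1.P i.1.2.2) 0 => JetSup.equiv _ _ _ A₁ (bondEquiv i.1.1 i.1.2.2 b))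
              + (fun b : PBond (i.1.1.P i.1.2.2) 0 => JetSup.equiv _ _ _ (H1f i.1.1 i.1.2.1 i.1.2.2 i.2.2.le (c₀ L) (cB L) (a L i) (DeltaOnePJ i.1.1 i.1.2.1 i.1.2.2 i.2.2.le (c₀ L) (cB L) (a L i)) U₀ (fun c : PBond (i.1.1.P i.1.2.1) 0 =>
          (-Complex.I) • mlog (((V c : Matrix.specialUnitaryGroup (Fin 2) ℂ) : Matrix (Fin 2) (Fin 2) ℂ)
            * star ((descendTo i.1.1 ℰp i.1.2.1 i.1.2.2 i.2.2.le U₀ c : Matrix.specialUnitaryGroup (Fin 2) ℂ) : Matrix (Fin 2) (Fin 2) ℂ)))) (bondEquiv i.1.1 i.1.2.2 b)))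
                  + (t : ℂ) • ((((eta i.1.1 i.1.2.1 i.1.2.2 : ℝ) : ℂ) * Complex.I) • fun b' : PBond (i.1.1.P i.1.2.2) 0 => JetSup.equiv _ _ _ δ' (bondEquiv i.1.1 i.1.2.2 b')))
                - H46P i.1.1 i.1.2.1 i.1.2.2 i.2.2.le (c₀ L) (cB L) (a L i) U₀ (Dfix (CmapTwS i.1.1 i.1.2.1 i.1.2.2 i.2.2.le U₀) (H46P i.1.1 i.1.2.1 i.1.2.2 i.2.2.le (c₀ L) (cB L) (a L i) U₀) (40 * (2 * (3 * (2 * ef L + 2700 * (i.1.1.L : ℝ) * α L))) / (ef L * eta i.1.1 i.1.2.1 i.1.2.2) ^ 2)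
                    ((((eta i.1.1 i.1.2.1 i.1.2.2 : ℝ) : ℂ) * Complex.I) • ((fun b : PBond (i.1.1.P i.1.2.2) 0 => JetSup.equiv _ _ _ A₁ (bondEquiv i.1.1 i.1.2.2 b))
              + (fun b : PBond (i.1.1.P i.1.2.2) 0 => JetSup.equiv _ _ _ (H1f i.1.1 i.1.2.1 i.1.2.2 i.2.2.le (c₀ L) (cB L) (a L i) (DeltaOnePJ i.1.1 i.1.2.1 i.1.2.2 i.2.2.le (c₀ L) (cB L) (a L i)) U₀ (fun c : PBond (i.1.1.P i.1.2.1) 0 =>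
          (-Complex.I) • mlog (((V c : Matrix.specialUnitaryGroup (Fin 2) ℂ) : Matrix (Fin 2) (Fin 2) ℂ)
            * star ((descendTo i.1.1 ℰp i.1.2.1 i.1.2.2 i.2.2.le U₀ c : Matrix.specialUnitaryGroup (Fin 2) ℂ) : Matrix (Fin 2) (Fin 2) ℂ)))) (bondEquiv i.1.1 i.1.2.2 b)))
                  + (t : ℂ) • ((((eta i.1.1 i.1.2.1 i.1.2.2 : ℝ) : ℂ) * Complex.I) • fun b' : PBond (i.1.1.P i.1.2.2) 0 => JetSup.equiv _ _ _ δ' (bondEquiv i.1.1 i.1.2.2 b')))))) :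
    ∀ (L : ℕ), 1 < L → ∀ (i : Idx L) (ε₁ : ℝ) (V : GaugeField (i.1.1.P i.1.2.1) 0 (Matrix.specialUnitaryGroup (Fin 2) ℂ))
      (U₀ : GaugeField (i.1.1.P i.1.2.2) 0 (Matrix.specialUnitaryGroup (Fin 2) ℂ)), 0 < ε₁ → PlaqSmall ε₁ V →
      RegPr i.1.1 i.1.2.1 i.1.2.2 ((L : ℝ) ^ 3 * (3 * (L : ℝ)) * ε₁) U₀ → CloseAvg i.1.1 i.1.2.1 i.1.2.2 i.2.2.le ((L : ℝ) ^ 3 * ε₁) V U₀ → Lift L i U₀ → (L : ℝ) ^ 3 * (3 * (L : ℝ)) * ε₁ ≤ α L →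
      ∀ A₁ : Space115 (i.1.1.L : ℝ) (((i.1.1.L : ℝ)⁻¹) ^ (i.1.2.2 - i.1.2.1)) (fun _ : Bond 3 (periodsT3 i.1.1 i.1.2.2) => i.1.2.2 - i.1.2.1)
          (fun _ : Bond 3 (periodsT3 i.1.1 i.1.2.2) × Fin 3 => i.1.2.2 - i.1.2.1) (nabla115 (((i.1.1.L : ℝ)⁻¹) ^ (i.1.2.2 - i.1.2.1)) (bgOfCfg i.1.1 i.1.2.2 U₀)),
        ‖A₁‖ < r L →
        A₁ + frakGfR i.1.1 i.1.2.1 i.1.2.2 i.2.2.le (c₀ L) (cB L) (a L i) (DeltaOnePJ i.1.1 i.1.2.1 i.1.2.2 i.2.2.le (c₀ L) (cB L) (a L i)) U₀ (Jcur (bgOfCfg i.1.1 i.1.2.2 U₀)) + frakGfR i.1.1 i.1.2.1 i.1.2.2 i.2.2.le (c₀ L) (cB L) (a L i) (DeltaOnePJ i.1.1 i.1.2.1 i.1.2.2 i.2.2.le (c₀ L) (cB L) (a L i)) U₀ (Wf L i U₀ (A₁ + H1f i.1.1 i.1.2.1 i.1.2.2 i.2.2.le (c₀ L) (cB L) (a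 L i) (DeltaOnePJ i.1.1 i.1.2.1 i.1.2.2 i.2.2.le (c₀ L) (cB L) (a L i)) U₀ (fun c : PBond (i.1.1.P i.1.2.1) 0 =>
          (-Complex.I) • mlog (((V c : Matrix.specialUnitaryGroup (Fin 2) ℂ) : Matrix (Fin 2) (Fin 2) ℂ)
            * star ((descendTo i.1.1 ℰp i.1.2.1 i.1.2.2 i.2.2.le U₀ c : Matrix.specialUnitaryGroup (Fin 2) ℂ) : Matrix (Fin 2) (Fin 2) ℂ))))) = 0 →
        ∀ δ : PBond (i.1.1.P i.1.2.2) 0 → Matrix (Fin 2) (Fin 2) ℂ, (∀ b', star (δ b') = -δ b' ∧ (δ b').trace = 0) → QTwS i.1.1 i.1.2.1 i.1.2.2 i.2.2.le U₀ δ = 0 →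
          IsLandauPrintS i.1.1 i.1.2.1 i.1.2.2 i.2.2.le (c₀ L) (cB L) U₀ δ →
          deriv (fun t : ℝ => wilsonAction4 (emb15 U₀ (expHermField (fun b' : PBond (i.1.1.P i.1.2.2) 0 => (-Complex.I) •
            (((((eta i.1.1 i.1.2.1 i.1.2.2 : ℝ) : ℂ) * Complex.I) • ((fun b : PBond (i.1.1.P i.1.2.2) 0 => JetSup.equiv _ _ _ A₁ (bondEquiv i.1.1 i.1.2.2 b))
              + (fun b : PBond (i.1.1.P i.1.2.2) 0 => JetSup.equiv _ _ _ (H1f i.1.1 i.1.2.1 i.1.2.2 i.2.2.le (c₀ L) (cB L) (a L i) (DeltaOnePJ i.1.1 i.1.2.1 i.1.2.2 i.2.2.le (c₀ L) (cB L) (a L i)) U₀ (fun c : PBond (i.1.1.P i.1.2.1) 0 =>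
          (-Complex.I) • mlog (((V c : Matrix.specialUnitaryGroup (Fin 2) ℂ) : Matrix (Fin 2) (Fin 2) ℂ)
            * star ((descendTo i.1.1 ℰp i.1.2.1 i.1.2.2 i.2.2.le U₀ c : Matrix.specialUnitaryGroup (Fin 2) ℂ) : Matrix (Fin 2) (Fin 2) ℂ)))) (bondEquiv i.1.1 i.1.2.2 b))) + (t : ℂ) • δ)
            - H46P i.1.1 i.1.2.1 i.1.2.2 i.2.2.le (c₀ L) (cB L) (a L i) U₀ (Dfix (CmapTwS i.1.1 i.1.2.1 i.1.2.2 i.2.2.le U₀) (H46P i.1.1 i.1.2.1 i.1.2.2 i.2.2.le (c₀ L) (cB L) (a L i) U₀) (40 * (2 * (3 * (2 * ef L + 2700 * (i.1.1.L : ℝ) * α L))) / (ef L * eta i.1.1 i.1.2.1 i.1.2.2) ^ 2)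
              ((((eta i.1.1 i.1.2.1 i.1.2.2 : ℝ) : ℂ) * Complex.I) • ((fun b : PBond (i.1.1.P i.1.2.2) 0 => JetSup.equiv _ _ _ A₁ (bondEquiv i.1.1 i.1.2.2 b))
              + (fun b : PBond (i.1.1.P i.1.2.2) 0 => JetSup.equiv _ _ _ (H1f i.1.1 i.1.2.1 i.1.2.2 i.2.2.le (c₀ L) (cB L) (a L i) (DeltaOnePJ i.1.1 i.1.2.1 i.1.2.2 i.2.2.le (c₀ L) (cB L) (a L i)) U₀ (fun c : PBond (i.1.1.P i.1.2.1) 0 =>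
          (-Complex.I) • mlog (((V c : Matrix.specialUnitaryGroup (Fin 2) ℂ) : Matrix (Fin 2) (Fin 2) ℂ)
            * star ((descendTo i.1.1 ℰp i.1.2.1 i.1.2.2 i.2.2.le U₀ c : Matrix.specialUnitaryGroup (Fin 2) ℂ) : Matrix (Fin 2) (Fin 2) ℂ)))) (bondEquiv i.1.1 i.1.2.2 b))) + (t : ℂ) • δ))) b')))) 0 = 0 := by
  intro L hL i ε₁ V U₀ hε₁ hV hreg hclose hLift hαe A₁ hA₁ hsol δ hδR hδQ hδL
  have hFL' : (i.1.1.L : ℝ) = (L : ℝ) := (by exact_mod_cast i.2.1); have hL1 : (1 : ℝ) ≤ (L : ℝ) := (by exact_mod_cast hL.le)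
  have hL3 : (3 : ℝ) ≤ (L : ℝ) := by rw [← hFL']; exact three_le_memberL i
  obtain ⟨s3, -⟩ := windows_of_W hL3 (hα L hL).le (hef L hL).le (hWe L hL) (hWε L hL)
  have hWe' : 10 ^ 9 * (i.1.1.L : ℝ) ^ 2 * ef L ≤ 1 := by rw [hFL']; exact hWe L hL
  have hWε' : 10 ^ 12 * (i.1.1.L : ℝ) ^ 3 * α L ≤ 1 := by rw [hFL']; exact hWε L hL
  have hWQ' : 13 * 10 ^ 14 * (i.1.1.L : ℝ) ^ 3 * α L ≤ 1 := by rw [hFL']; exact hWQ L hL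
  have hregα : RegPr i.1.1 i.1.2.1 i.1.2.2 (α L) U₀ := regPr_mono i.1.1 hαe hreg
  have hHB := h46₀ L hL i U₀ hregα hLift; have hHR := hHfR L hL i U₀ hregα
  have hα0 : 0 < α L := hα L hL; have he0 : 0 < ef L := hef L hL
  have hηpos : 0 < eta i.1.1 i.1.2.1 i.1.2.2 := T3SectALandauChart.eta_pos i.1.1 i.1.2.1 i.1.2.2
  have hb : 0 ≤ BH L * eta i.1.1 i.1.2.1 i.1.2.2 := mul_nonneg (hBH0 L hL) hηpos.le
  -- the class at the letter slot `Δ₁ᴾ`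
  have hp : PosOnto i.1.1 i.1.2.1 i.1.2.2 i.2.2.le (c₀ L) (cB L) (a L i) (DeltaOnePJ i.1.1 i.1.2.1 i.1.2.2 i.2.2.le (c₀ L) (cB L) (a L i)) U₀ :=
    ⟨hPos₁ L hL i U₀ hregα hLift, surjective_Qk_of_regPr i.1.1 i.2.2.le i.2.2 (c₀ L) (cB L) hregα hWQ'⟩
  -- the contraction regime of (51) in η-form (T6's numerics): `9·C₂ˢ·(B_H η)·(η ε′) = 9·(40M₀ˢ∕e²)·B_H·ε′`, `6ηε′ ≤ eη`
  have hq' : 9 * (40 * (2 * (3 * (2 * ef L + 2700 * (i.1.1.L : ℝ) * α L))) / (ef L * eta i.1.1 i.1.2.1 i.1.2.2) ^ 2)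
      * (BH L * eta i.1.1 i.1.2.1 i.1.2.2) * (eta i.1.1 i.1.2.1 i.1.2.2 * ε' L) < 1 := by
    have hcalc : 9 * (40 * (2 * (3 * (2 * ef L + 2700 * (i.1.1.L : ℝ) * α L))) / (ef L * eta i.1.1 i.1.2.1 i.1.2.2) ^ 2)
        * (BH L * eta i.1.1 i.1.2.1 i.1.2.2) * (eta i.1.1 i.1.2.1 i.1.2.2 * ε' L) = 9 * (40 * (2 * (3 * (2 * ef L + 2700 * (i.1.1.L : ℝ) * α L))) / ef L ^ 2) * BH L * ε' L := by field_simp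
    rw [hcalc, hFL']; exact hq47 L hL
  have hRε' : 6 * (eta i.1.1 i.1.2.1 i.1.2.2 * ε' L) ≤ ef L * eta i.1.1 i.1.2.1 i.1.2.2 := by
    linarith only [mul_le_mul_of_nonneg_left (hR6 L hL) hηpos.le]
  -- `‖H₁B̃‖ ≤ 2B₀α` from `norm_H₁` ∘ (20) and `L³·3L·ε₁ ≤ α`
  have hwin : (i.1.1.L : ℝ) ^ 3 * ε₁ ≤ 1 / 2 := by rw [hFL']; exact (windows_of_admissible hL1 hε₁.le hαe s3).1
  have hclose' : CloseAvg i.1.1 i.1.2.1 i.1.2.2 i.2.2.le ((i.1.1.L : ℝ) ^ 3 * ε₁) V U₀ := by rw [hFL']; exact hclose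
  have hB := bound20_symLog_of_closeAvg i.1.1 i.2.2.le hε₁ hwin V U₀ hclose'
  -- (R-B) the pinned datum is Hermitian-traceless, (R-A₁) the solution is real, (R-H₁)
  obtain ⟨-, -, hα16⟩ := windows_of_admissible hL1 hε₁.le hαe s3
  have h13 : (i.1.1.L : ℝ) ^ 3 * ε₁ ≤ 1 / 3 := by
    rw [hFL']
    have h0 : 0 ≤ (L : ℝ) ^ 3 * ε₁ := by positivity
    nlinarith only [h0, hαe.trans hα16, mul_nonneg h0 (by linarith only [hL1] : (0 : ℝ) ≤ 3 * (L : ℝ) - 1)]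
  have hBR := bsym_isHermitian_trace_zero i.1.1 i.2.2.le V U₀ h13 hclose'
  have hιA := hA₁R_of_letterReality Lift B₀ C₄ a₃ α r hB₀ hC₄
    (fun (L : ℕ) (i : Idx L) (U₀ : GaugeField (i.1.1.P i.1.2.2) 0 (Matrix.specialUnitaryGroup (Fin 2) ℂ)) => frakGfR i.1.1 i.1.2.1 i.1.2.2 i.2.2.le (c₀ L) (cB L) (a L i) (DeltaOnePJ i.1.1 i.1.2.1 i.1.2.2 i.2.2.le (c₀ L) (cB L) (a L i)) U₀) Wf
    (fun (L : ℕ) (i : Idx L) (U₀ : GaugeField (i.1.1.P i.1.2.2) 0 (Matrix.specialUnitaryGroup (Fin 2) ℂ)) => H1f i.1.1 i.1.2.1 i.1.2.2 i.2.2.le (c₀ L) (cB L) (a L i) (DeltaOnePJ i.1.1 i.1.2.1 i.1.2.2 i.2.2.le (c₀ L) (cB L) (a L i)) U₀)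
    norm_G prop4 norm_H₁ hWε h𝒢R hWR hrα hr4 hr16 hH₁R L hL i ε₁ V U₀ hε₁ hV hreg hclose hLift hαe A₁ hA₁ hsol
  have hH₁B : ‖H1f i.1.1 i.1.2.1 i.1.2.2 i.2.2.le (c₀ L) (cB L) (a L i) (DeltaOnePJ i.1.1 i.1.2.1 i.1.2.2 i.2.2.le (c₀ L) (cB L) (a L i)) U₀ (fun c : PBond (i.1.1.P i.1.2.1) 0 =>
          (-Complex.I) • mlog (((V c : Matrix.specialUnitaryGroup (Fin 2) ℂ) : Matrix (Fin 2) (Fin 2) ℂ)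
            * star ((descendTo i.1.1 ℰp i.1.2.1 i.1.2.2 i.2.2.le U₀ c : Matrix.specialUnitaryGroup (Fin 2) ℂ) : Matrix (Fin 2) (Fin 2) ℂ)))‖ ≤ 2 * B₀ L * α L := by
    have h0 := norm_H₁ L hL i _ U₀ hreg hαe hLift (fun c : PBond (i.1.1.P i.1.2.1) 0 =>
          (-Complex.I) • mlog (((V c : Matrix.specialUnitaryGroup (Fin 2) ℂ) : Matrix (Fin 2) (Fin 2) ℂ)
            * star ((descendTo i.1.1 ℰp i.1.2.1 i.1.2.2 i.2.2.le U₀ c : Matrix.specialUnitaryGroup (Fin 2) ℂ) : Matrix (Fin 2) (Fin 2) ℂ)))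
    have hB' : ‖(fun c : PBond (i.1.1.P i.1.2.1) 0 =>
          (-Complex.I) • mlog (((V c : Matrix.specialUnitaryGroup (Fin 2) ℂ) : Matrix (Fin 2) (Fin 2) ℂ)
            * star ((descendTo i.1.1 ℰp i.1.2.1 i.1.2.2 i.2.2.le U₀ c : Matrix.specialUnitaryGroup (Fin 2) ℂ) : Matrix (Fin 2) (Fin 2) ℂ)))‖ ≤ 2 * α L := by
      have h3 : 2 * ((3 : ℝ) * i.1.1.L) * ((i.1.1.L : ℝ) ^ 3 * ε₁) = 2 * ((L : ℝ) ^ 3 * (3 * (L : ℝ)) * ε₁) := by rw [hFL']; ring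
      rw [h3] at hB; linarith only [hB, hαe]
    calc _ ≤ B₀ L * _ := h0
      _ ≤ B₀ L * (2 * α L) := mul_le_mul_of_nonneg_left hB' (hB₀ L hL).le
      _ = 2 * B₀ L * α L := by ring
  have hιB := hH₁R L hL i U₀ hregα _ hBR
  -- the chart value's field `A′ := A₁ + H₁B̃` read through ONE reader (`rfl`)
  have hfun0 : ∀ Z : Space115 (i.1.1.L : ℝ) (((i.1.1.L : ℝ)⁻¹) ^ (i.1.2.2 - i.1.2.1)) (fun _ : Bond 3 (periodsT3 i.1.1 i.1.2.2) => i.1.2.2 - i.1.2.1)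
          (fun _ : Bond 3 (periodsT3 i.1.1 i.1.2.2) × Fin 3 => i.1.2.2 - i.1.2.1) (nabla115 (((i.1.1.L : ℝ)⁻¹) ^ (i.1.2.2 - i.1.2.1)) (bgOfCfg i.1.1 i.1.2.2 U₀)),
      ((fun b : PBond (i.1.1.P i.1.2.2) 0 => JetSup.equiv _ _ _ A₁ (bondEquiv i.1.1 i.1.2.2 b))
        + (fun b : PBond (i.1.1.P i.1.2.2) 0 => JetSup.equiv _ _ _ Z (bondEquiv i.1.1 i.1.2.2 b)))
      = fun b : PBond (i.1.1.P i.1.2.2) 0 => JetSup.equiv _ _ _ (A₁ + Z) (bondEquiv i.1.1 i.1.2.2 b) := fun Z => by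
    funext b
    rfl
  have hsplit0 : ∀ Z : Space115 (i.1.1.L : ℝ) (((i.1.1.L : ℝ)⁻¹) ^ (i.1.2.2 - i.1.2.1)) (fun _ : Bond 3 (periodsT3 i.1.1 i.1.2.2) => i.1.2.2 - i.1.2.1)
          (fun _ : Bond 3 (periodsT3 i.1.1 i.1.2.2) × Fin 3 => i.1.2.2 - i.1.2.1) (nabla115 (((i.1.1.L : ℝ)⁻¹) ^ (i.1.2.2 - i.1.2.1)) (bgOfCfg i.1.1 i.1.2.2 U₀)), ∀ b' : PBond (i.1.1.P i.1.2.2) 0,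
      JetSup.equiv _ _ _ (A₁ + Z) (bondEquiv i.1.1 i.1.2.2 b') = JetSup.equiv _ _ _ A₁ (bondEquiv i.1.1 i.1.2.2 b') + JetSup.equiv _ _ _ Z (bondEquiv i.1.1 i.1.2.2 b') :=
    fun Z b' => rfl
  have hA'R : ∀ b' : PBond (i.1.1.P i.1.2.2) 0, (JetSup.equiv _ _ _ (A₁ + H1f i.1.1 i.1.2.1 i.1.2.2 i.2.2.le (c₀ L) (cB L) (a L i) (DeltaOnePJ i.1.1 i.1.2.1 i.1.2.2 i.2.2.le (c₀ L) (cB L) (a L i)) U₀ (fun c : PBond (i.1.1.P i.1.2.1) 0 =>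
          (-Complex.I) • mlog (((V c : Matrix.specialUnitaryGroup (Fin 2) ℂ) : Matrix (Fin 2) (Fin 2) ℂ)
            * star ((descendTo i.1.1 ℰp i.1.2.1 i.1.2.2 i.2.2.le U₀ c : Matrix.specialUnitaryGroup (Fin 2) ℂ) : Matrix (Fin 2) (Fin 2) ℂ)))) (bondEquiv i.1.1 i.1.2.2 b')).IsHermitian ∧
      (JetSup.equiv _ _ _ (A₁ + H1f i.1.1 i.1.2.1 i.1.2.2 i.2.2.le (c₀ L) (cB L) (a L i) (DeltaOnePJ i.1.1 i.1.2.1 i.1.2.2 i.2.2.le (c₀ L) (cB L) (a L i)) U₀ (fun c : PBond (i.1.1.P i.1.2.1) 0 =>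
          (-Complex.I) • mlog (((V c : Matrix.specialUnitaryGroup (Fin 2) ℂ) : Matrix (Fin 2) (Fin 2) ℂ)
            * star ((descendTo i.1.1 ℰp i.1.2.1 i.1.2.2 i.2.2.le U₀ c : Matrix.specialUnitaryGroup (Fin 2) ℂ) : Matrix (Fin 2) (Fin 2) ℂ)))) (bondEquiv i.1.1 i.1.2.2 b')).trace = 0 := fun b' => by
    rw [hsplit0]
    exact ⟨(hιA b').1.add (hιB b').1, by rw [Matrix.trace_add, (hιA b').2, (hιB b').2, add_zero]⟩
  -- sizes: `‖A′‖ < r + 2B₀α`, so `κ_f • ιA′` lies in the HALF ball of radius `η·ε′` (`hrε2`)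
  have hA'n : ‖A₁ + H1f i.1.1 i.1.2.1 i.1.2.2 i.2.2.le (c₀ L) (cB L) (a L i) (DeltaOnePJ i.1.1 i.1.2.1 i.1.2.2 i.2.2.le (c₀ L) (cB L) (a L i)) U₀ (fun c : PBond (i.1.1.P i.1.2.1) 0 =>
          (-Complex.I) • mlog (((V c : Matrix.specialUnitaryGroup (Fin 2) ℂ) : Matrix (Fin 2) (Fin 2) ℂ)
            * star ((descendTo i.1.1 ℰp i.1.2.1 i.1.2.2 i.2.2.le U₀ c : Matrix.specialUnitaryGroup (Fin 2) ℂ) : Matrix (Fin 2) (Fin 2) ℂ)))‖ < r L + 2 * B₀ L * α L := lt_of_le_of_lt (norm_add_le _ _) (add_lt_add_of_lt_of_le hA₁ hH₁B)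
  have hnI : ‖(((eta i.1.1 i.1.2.1 i.1.2.2 : ℝ) : ℂ) * Complex.I)‖ = eta i.1.1 i.1.2.1 i.1.2.2 := by
    rw [norm_mul, Complex.norm_I, mul_one, Complex.norm_real, Real.norm_of_nonneg hηpos.le]
  have hA'ε : ‖(((eta i.1.1 i.1.2.1 i.1.2.2 : ℝ) : ℂ) * Complex.I) • (fun b : PBond (i.1.1.P i.1.2.2) 0 => JetSup.equiv _ _ _ (A₁ + H1f i.1.1 i.1.2.1 i.1.2.2 i.2.2.le (c₀ L) (cB L) (a L i) (DeltaOnePJ i.1.1 i.1.2.1 i.1.2.2 i.2.2.le (c₀ L) (cB L) (a L i)) U₀ (fun c : PBond (i.1.1.P i.1.2.1) 0 =>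
          (-Complex.I) • mlog (((V c : Matrix.specialUnitaryGroup (Fin 2) ℂ) : Matrix (Fin 2) (Fin 2) ℂ)
            * star ((descendTo i.1.1 ℰp i.1.2.1 i.1.2.2 i.2.2.le U₀ c : Matrix.specialUnitaryGroup (Fin 2) ℂ) : Matrix (Fin 2) (Fin 2) ℂ)))) (bondEquiv i.1.1 i.1.2.2 b))‖
      < eta i.1.1 i.1.2.1 i.1.2.2 * ε' L := by
    have hr0 : 0 ≤ r L := (norm_nonneg A₁).trans hA₁.le
    have key : ∀ x : ℝ, x < r L + 2 * B₀ L * α L → eta i.1.1 i.1.2.1 i.1.2.2 * x < eta i.1.1 i.1.2.1 i.1.2.2 * ε' L := fun x hx => by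
      have h2 : 0 ≤ 2 * B₀ L * α L := by have := (hB₀ L hL).le; positivity
      nlinarith only [mul_lt_mul_of_pos_left hx hηpos, mul_le_mul_of_nonneg_left (hrε2 L hL) hηpos.le, hηpos, hr0, h2]
    rw [norm_smul, hnI]
    exact key _ ((norm_jetRead_le i.1.1 _).trans_lt hA'n)
  -- the chart value `κ_f • ιA′` is skew-Hermitian traceless
  have hsI : star ((((eta i.1.1 i.1.2.1 i.1.2.2 : ℝ) : ℂ)) * Complex.I) = -((((eta i.1.1 i.1.2.1 i.1.2.2 : ℝ) : ℂ)) * Complex.I) := by simp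
  have hXsk : ∀ b', star (((((eta i.1.1 i.1.2.1 i.1.2.2 : ℝ) : ℂ) * Complex.I) • (fun b : PBond (i.1.1.P i.1.2.2) 0 => JetSup.equiv _ _ _ (A₁ + H1f i.1.1 i.1.2.1 i.1.2.2 i.2.2.le (c₀ L) (cB L) (a L i) (DeltaOnePJ i.1.1 i.1.2.1 i.1.2.2 i.2.2.le (c₀ L) (cB L) (a L i)) U₀ (fun c : PBond (i.1.1.P i.1.2.1) 0 =>
          (-Complex.I) • mlog (((V c : Matrix.specialUnitaryGroup (Fin 2) ℂ) : Matrix (Fin 2) (Fin 2) ℂ)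
            * star ((descendTo i.1.1 ℰp i.1.2.1 i.1.2.2 i.2.2.le U₀ c : Matrix.specialUnitaryGroup (Fin 2) ℂ) : Matrix (Fin 2) (Fin 2) ℂ)))) (bondEquiv i.1.1 i.1.2.2 b))) b')
      = -((((eta i.1.1 i.1.2.1 i.1.2.2 : ℝ) : ℂ) * Complex.I) • (fun b : PBond (i.1.1.P i.1.2.2) 0 => JetSup.equiv _ _ _ (A₁ + H1f i.1.1 i.1.2.1 i.1.2.2 i.2.2.le (c₀ L) (cB L) (a L i) (DeltaOnePJ i.1.1 i.1.2.1 i.1.2.2 i.2.2.le (c₀ L) (cB L) (a L i)) U₀ (fun c : PBond (i.1.1.P i.1.2.1) 0 =>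
          (-Complex.I) • mlog (((V c : Matrix.specialUnitaryGroup (Fin 2) ℂ) : Matrix (Fin 2) (Fin 2) ℂ)
            * star ((descendTo i.1.1 ℰp i.1.2.1 i.1.2.2 i.2.2.le U₀ c : Matrix.specialUnitaryGroup (Fin 2) ℂ) : Matrix (Fin 2) (Fin 2) ℂ)))) (bondEquiv i.1.1 i.1.2.2 b))) b' ∧
      Matrix.trace (((((eta i.1.1 i.1.2.1 i.1.2.2 : ℝ) : ℂ) * Complex.I) • (fun b : PBond (i.1.1.P i.1.2.2) 0 => JetSup.equiv _ _ _ (A₁ + H1f i.1.1 i.1.2.1 i.1.2.2 i.2.2.le (c₀ L) (cB L) (a L i) (DeltaOnePJ i.1.1 i.1.2.1 i.1.2.2 i.2.2.le (c₀ L) (cB L) (a L i)) U₀ (fun c : PBond (i.1.1.P i.1.2.1) 0 =>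
          (-Complex.I) • mlog (((V c : Matrix.specialUnitaryGroup (Fin 2) ℂ) : Matrix (Fin 2) (Fin 2) ℂ)
            * star ((descendTo i.1.1 ℰp i.1.2.1 i.1.2.2 i.2.2.le U₀ c : Matrix.specialUnitaryGroup (Fin 2) ℂ) : Matrix (Fin 2) (Fin 2) ℂ)))) (bondEquiv i.1.1 i.1.2.2 b))) b') = 0 := fun b' => by
    simp only [Pi.smul_apply]
    exact ⟨by rw [star_smul, Matrix.star_eq_conjTranspose, (hA'R b').1.eq, hsI, neg_smul], by rw [Matrix.trace_smul, (hA'R b').2, smul_zero]⟩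
  -- the slice direction read back into the (115)-space: `ιδ′ = (ηi)⁻¹ • δ` (Hermitian), `κ_f • ιδ′ = δ`
  have hκ : ((((eta i.1.1 i.1.2.1 i.1.2.2 : ℝ) : ℂ)) * Complex.I) ≠ 0 :=
    mul_ne_zero (Complex.ofReal_ne_zero.2 hηpos.ne') Complex.I_ne_zero
  set δ' : Space115 (i.1.1.L : ℝ) (((i.1.1.L : ℝ)⁻¹) ^ (i.1.2.2 - i.1.2.1)) (fun _ : Bond 3 (periodsT3 i.1.1 i.1.2.2) => i.1.2.2 - i.1.2.1)
      (fun _ : Bond 3 (periodsT3 i.1.1 i.1.2.2) × Fin 3 => i.1.2.2 - i.1.2.1) (nabla115 (((i.1.1.L : ℝ)⁻¹) ^ (i.1.2.2 - i.1.2.1)) (bgOfCfg i.1.1 i.1.2.2 U₀)) :=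
    fun p => (((((eta i.1.1 i.1.2.1 i.1.2.2 : ℝ) : ℂ)) * Complex.I)⁻¹ • δ) ((bondEquiv i.1.1 i.1.2.2).symm p) with hδ'
  have hιb : ∀ b' : PBond (i.1.1.P i.1.2.2) 0, JetSup.equiv _ _ _ δ' (bondEquiv i.1.1 i.1.2.2 b') = (((((eta i.1.1 i.1.2.1 i.1.2.2 : ℝ) : ℂ)) * Complex.I)⁻¹ • δ) b' := fun b' => by
    show (((((eta i.1.1 i.1.2.1 i.1.2.2 : ℝ) : ℂ)) * Complex.I)⁻¹ • δ) ((bondEquiv i.1.1 i.1.2.2).symm (bondEquiv i.1.1 i.1.2.2 b')) = _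
    rw [Equiv.symm_apply_apply]
  have hι : (fun b' : PBond (i.1.1.P i.1.2.2) 0 => JetSup.equiv _ _ _ δ' (bondEquiv i.1.1 i.1.2.2 b')) = ((((eta i.1.1 i.1.2.1 i.1.2.2 : ℝ) : ℂ)) * Complex.I)⁻¹ • δ :=
    funext hιb
  have hηδ : ((((eta i.1.1 i.1.2.1 i.1.2.2 : ℝ) : ℂ)) * Complex.I) • (fun b' : PBond (i.1.1.P i.1.2.2) 0 => JetSup.equiv _ _ _ δ' (bondEquiv i.1.1 i.1.2.2 b')) = δ := by
    rw [hι, smul_smul, mul_inv_cancel₀ hκ, one_smul]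
  have hsIinv : star (((((eta i.1.1 i.1.2.1 i.1.2.2 : ℝ) : ℂ)) * Complex.I)⁻¹) = -(((((eta i.1.1 i.1.2.1 i.1.2.2 : ℝ) : ℂ)) * Complex.I)⁻¹) := by
    rw [star_inv₀, hsI, inv_neg]
  have hδR' : ∀ b' : PBond (i.1.1.P i.1.2.2) 0, star (JetSup.equiv _ _ _ δ' (bondEquiv i.1.1 i.1.2.2 b')) = JetSup.equiv _ _ _ δ' (bondEquiv i.1.1 i.1.2.2 b') := fun b' => by
    rw [hιb b', Pi.smul_apply, star_smul, (hδR b').1, hsIinv, neg_smul, smul_neg, neg_neg]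
  have hδtr' : ∀ b' : PBond (i.1.1.P i.1.2.2) 0, Matrix.trace (JetSup.equiv _ _ _ δ' (bondEquiv i.1.1 i.1.2.2 b')) = 0 := fun b' => by
    rw [hιb b', Pi.smul_apply, Matrix.trace_smul, (hδR b').2, smul_zero]
  have hδQ' : QTwS i.1.1 i.1.2.1 i.1.2.2 i.2.2.le U₀ (fun b' : PBond (i.1.1.P i.1.2.2) 0 => JetSup.equiv _ _ _ δ' (bondEquiv i.1.1 i.1.2.2 b')) = 0 := by
    rw [hι, map_smul, hδQ, smul_zero]
  have hδL' : IsLandauPrintS i.1.1 i.1.2.1 i.1.2.2 i.2.2.le (c₀ L) (cB L) U₀ (fun b' : PBond (i.1.1.P i.1.2.2) 0 => JetSup.equiv _ _ _ δ' (bondEquiv i.1.1 i.1.2.2 b')) := by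
    rw [hι, isLandauPrintS_iff_RS, map_smul, map_smul, map_smul, (isLandauPrintS_iff_RS U₀ δ).mp hδL, smul_zero]
  -- the display rows at the member, direction `δ′`; the conjugacy row re-read at `δ = κ_f • ιδ′`
  have hZ := hZ84 L hL i ε₁ V U₀ hε₁ hV hreg hclose hLift hαe A₁ hA₁ hsol δ' hδR' hδtr' hδQ'
  have hch := hchart L hL i ε₁ V U₀ hε₁ hV hreg hclose hLift hαe A₁ hA₁ hsol δ' hδR' hδtr' hδQ'
  rw [hηδ] at hch
  -- reality of the chart value along the ray near `t = 0` ((51))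
  have hXR := eventually_isHermitian_trace_zero_chart i.1.1 i.1.2.1 i.1.2.2 i.2.2.le (U₀ := U₀) hα0 he0 hWe' hWε' hregα
    (H := H46P i.1.1 i.1.2.1 i.1.2.2 i.2.2.le (c₀ L) (cB L) (a L i) U₀) hb hHB hHR hq' hRε' hA'ε hXsk hδR
  -- ★px21's two-slot assembly at `TJ := T_Jᴾ`, chart `χᴾ`
  have hmain := deriv_chartRay_eq_zero_of_eq111_twoSlot_ev (ha L i).le hp A₁ (Wf L i U₀) (Tcf L i U₀) (fun c : PBond (i.1.1.P i.1.2.1) 0 =>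
          (-Complex.I) • mlog (((V c : Matrix.specialUnitaryGroup (Fin 2) ℂ) : Matrix (Fin 2) (Fin 2) ℂ)
            * star ((descendTo i.1.1 ℰp i.1.2.1 i.1.2.2 i.2.2.le U₀ c : Matrix.specialUnitaryGroup (Fin 2) ℂ) : Matrix (Fin 2) (Fin 2) ℂ))) hsol
    (fun Y : PBond (i.1.1.P i.1.2.2) 0 → Matrix (Fin 2) (Fin 2) ℂ =>
      Y - H46P i.1.1 i.1.2.1 i.1.2.2 i.2.2.le (c₀ L) (cB L) (a L i) U₀ (Dfix (CmapTwS i.1.1 i.1.2.1 i.1.2.2 i.2.2.le U₀) (H46P i.1.1 i.1.2.1 i.1.2.2 i.2.2.le (c₀ L) (cB L) (a L i) U₀)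
        (40 * (2 * (3 * (2 * ef L + 2700 * (i.1.1.L : ℝ) * α L))) / (ef L * eta i.1.1 i.1.2.1 i.1.2.2) ^ 2) Y))
    δ hδR' hδQ' hδL' hZ hch hXR
  rw [hfun0] at hmain ⊢
  exact hmain

end Summit.QuantumFields.YangMills.Theorems.Prop7HCrit93OfRow84FamilyLift

end
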